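import Literature.MathematicalPhysics.QuantumFieldTheory.Balaban1983to89.B8Eq138Multiplier

/-!
# `Balaban1983to89.B8Eq195Linear` — T. Bałaban, *Spaces of regular gauge field configurations on a lattice and gauge fixing
# conditions*, Commun. Math. Phys. **99** (1985) 75–102 [Balaban1985RegularSpaces] ("B8"), Sect. D pp. 92–93: THE LINEAR-ALGEBRA
# SKELETON OF (1.93) → (1.95) → (1.100) — «Q′G′R = 0», «RΔλ = Δλ for λ satisfying Q′λ = 0», «ΔG′R = R», and the equivalence of the
# fixed-point equation λ = G′R(D*A + 𝔊(λ)) with the pair (Landau condition for the gauge-fixed field, Q′λ = 0) — over an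
# ARBITRARY ring and modules, from the (3.25) inverse laws of [4] alone, with the nonlinearity 𝔊 an arbitrary map

statement-level skeleton of published theorems with citation tags; proofs where landed; nothing here is a claim about the
Yang–Mills mass gap

PDF held: `paper:balaban1985-cmp99-regular-spaces-gauge-fixing` (journal page = PDF page + 74), pp. 91–93 [PDF 17–19] read on the text
layer by this seat (2026-08-26); [4] = [Balaban1985BackgroundPropagators] (3.24)–(3.25) p. 394 through `B9Eq325Proj`.

WHAT IS PRINTED (pp. 92–93, verbatim where legible).  (1.93): the change of variables `λ → λ − H′D′(u₁, λ)` applied to (1.90) gives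
*"−R𝔊(…) = 0, Q′λ = 0. (1.93)"*; *"The first term in the first equation can be written as (1.94) because RΔλ = Δλ for λ satisfying
Q′λ = 0. … Multiplying Eq. (1.93) by an inverse operator we obtain the equations Δλ − RD\*A − R𝔊(λ, Dλ, A, D\*A) = 0, Q′λ = 0.
(1.95)"*; p. 93: *"Equations (1.95) can be changed into the equivalent equation λ = G′RD\*A + G′R𝔊(λ, Dλ, A, D\*A). (1.100) If λ is a
solution of this equation, then λ satisfies both Eqs. (1.95) because Q′G′R = Q′G′(I − G′Q′\*(Q′G′²Q′\*)^{−1}Q′G′) = 0. Of course (1.95)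
imply (1.100). A solution of this equation may be interpreted as a fixed point of the transformation given by the right-hand side"*.
Here `R = I − G′Q′\*(Q′G′²Q′\*)^{−1}Q′G′`, `G′ = (Δ′_a)^{−1}`, `Δ′_a = Δ + Q′\*aQ′` ((1.91); [4] (3.24)–(3.25)).

WHY THIS FILE (cell `pub-ymgap`, seat `pub-ymgap-dag-n05-a` g4, KNIT seat of DAG node N05 = [B8]).  The Theorem-4 knit on the concrete
carriers (`B8Thm4InductionLocal.thm4_exists_all_levels`, `B8Prop3GaugeFixedKLevel.thm4_exists_all_levels_of_b9`) leaves Proposition 5 as the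
sockets `hP5base` / `hP5 m` / `hP5u`, whose provider must turn a fixed point of (1.100) (Sect. D–E: `B8SectDSource`, `B8Eq1117KLevel`,
`B8Claim97KLevel` of the n05-b lineage) into the LANDAU CONDITION (1.38) of the gauge-fixed field plus the linearised restriction
`Q′λ = 0`.  Print does this by the three operator identities quoted above; `B8.landau_projection_identities` certifies them as identities
in ONE ring (square case).  This file proves them for LINEAR MAPS BETWEEN TWO MODULES (E = site functions ⊇ L²(Ω₀, 𝔤), F = functions on
𝔅_k), from the four (3.25) inverse laws only (`g` a two-sided inverse of Δ′_a, `c` a two-sided inverse of Q′G′²Q′\*; no scalar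
product, symmetry or positivity), with `R` entered as ANY map satisfying `R f = f − G′Q′\*c Q′G′ f`, and packages print's «(1.95) ⟺
(1.100)» with the Landau condition read in the MULTIPLIER FORM of the sibling `B8Eq138Multiplier` («R Y = 0 ⟺ ∃ μ, Δ Y = Q′\* μ»): for an
ARBITRARY map `N : E → E` (the nonlinearity `−𝔊`, or `+G′`-sources for Theorem 8) and any `Y` (= D\*A),
  `λ = G′R(Y − N λ)  ⟺  Q′λ = 0 ∧ ∃ μ, Δ(Y − Δλ − N λ) = Q′\* μ`   (`fixedPoint_iff_constraint_and_multiplier`).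
So a Prop-5 provider on ANY carrier proves the multiplier-form Landau condition of the gauge-fixed field (whose `D\*` of the exponent
is `Y − Δλ − Nλ` by (1.86)–(1.88)) by exhibiting the fixed point — the letters G′, c, R being hypotheses with these four laws
relative to the carrier's concrete Δ, Q′, Q′ᵀ (on the `ℤᵈ × 𝔸` carriers: `B8Eq138LandauZd`).

WHAT THIS FILE PROVES (kernel, 0 sorry, theorems only, no `def`; ring `𝕜`, modules `E`, `F` arbitrary).
* `proj325_sub` (R is additive: `R (f − f′) = R f − R f′`), `q_g_proj325` («Q′G′R = 0», needs `c_right`), `proj325_lap_of_ker` («RΔλ = Δλ for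
  Q′λ = 0», needs `g_left`, `c`-free), `lap_g_proj325` («ΔG′R = R», needs `g_right`, `c_right`), `proj325_idem` (R² = R);
* `lap_eq_proj325_iff_of_ker` ((1.93) ⟺ (1.95): for `Q′λ = 0`, `R(Y − Δλ) = 0 ⟺ Δλ = R Y`), `eq_g_proj325_iff` ((1.95) ⟺ (1.100): `λ = G′R Y ⟺
  Q′λ = 0 ∧ Δλ = R Y`), **`fixedPoint_iff_constraint_and_landau`** (`λ = G′R(Y − Nλ) ⟺ Q′λ = 0 ∧ R(Y − Δλ − Nλ) = 0`),
  **`fixedPoint_iff_constraint_and_multiplier`** (the same with the multiplier form).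

HONEST SCOPE.  Linear algebra only: the nonlinearity is an arbitrary map and nothing is said about EXISTENCE of the fixed point
(Proposition 5: contraction (1.101)–(1.106), Sect. E), about the letters' existence ([4] Thm 3.11 = in-edge b9) or bounds ((1.92),
(1.98), (1.101)), or about the change of variables (1.113).  Count-neutral; N05 is not discharged by this file; nothing continuum / ℝ⁴ /
OS / mass-gap / Clay.  Unit `pub-ymgap-dag-n05-a` (g4), 2026-08-26.  Tree API by name only, nothing restated.
-/

namespace Literature.MathematicalPhysics.QuantumFieldTheory.Balaban1983to89.B8Eq195Linear

open B8Eq138Multiplier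

section Skeleton

variable {𝕜 : Type*} [Ring 𝕜] {E F : Type*} [AddCommGroup E] [Module 𝕜 E] [AddCommGroup F] [Module 𝕜 F]
variable {Δ : E →ₗ[𝕜] E} {q : E →ₗ[𝕜] F} {qs : F →ₗ[𝕜] E} {A : F →ₗ[𝕜] F} {g : E →ₗ[𝕜] E} {c : F →ₗ[𝕜] F}
variable {R : E → E}

/-- `R` is additive: `R(f − f′) = R f − R f′` (R = I − G′Q′\*c Q′G′ of (3.25) is a composite of additive maps). [cite: Balaban1985BackgroundPropagators, (3.25) p.394] -/
theorem proj325_sub (hR : ∀ f, R f = f - g (qs (c (q (g f))))) (f f' : E) : R (f - f') = R f - R f' := by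
  simp only [hR, map_sub]
  abel

/-- **«Q′G′R = Q′G′(I − G′Q′\*(Q′G′²Q′\*)^{−1}Q′G′) = 0»** (p. 93): `Q′G′R f = Q′G′f − (Q′G′²Q′\*)c(Q′G′f) = 0` by the right-inverse law of
`c`.  Consequently every `λ = G′R Y` obeys the linearised restriction `Q′λ = 0`. [cite: Balaban1985RegularSpaces, (1.100) p.93] -/
theorem q_g_proj325 (hR : ∀ f, R f = f - g (qs (c (q (g f))))) (c_right : ∀ φ : F, q (g (g (qs (c φ)))) = φ) (f : E) :
    q (g (R f)) = 0 := by
  rw [hR, map_sub, map_sub, c_right, sub_self]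

/-- **«RΔλ = Δλ for λ satisfying Q′λ = 0»** (p. 92, after (1.94)): `G′Δλ = G′Δ′_aλ = λ`, so `Q′G′Δλ = Q′λ = 0` and the correction
term of R vanishes. [cite: Balaban1985RegularSpaces, (1.94) p.92] -/
theorem proj325_lap_of_ker (hR : ∀ f, R f = f - g (qs (c (q (g f)))))
    (g_left : ∀ x : E, g (Δ x + qs (A (q x))) = x) {lam : E} (hlam : q lam = 0) :
    R (Δ lam) = Δ lam := by
  have hg : g (Δ lam) = lam := by
    have := g_left lam
    rwa [hlam, map_zero, map_zero, add_zero] at this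
  rw [hR, hg, hlam, map_zero, map_zero, map_zero, sub_zero]

/-- **«ΔG′R = R»** (the third identity behind (1.95), `B8.landau_projection_identities`): `Δ(G′y) = y − Q′\*aQ′G′y` (right-inverse law
of G′) and `Q′G′(R f) = 0`. [cite: Balaban1985RegularSpaces, (1.95) p.92] -/
theorem lap_g_proj325 (hR : ∀ f, R f = f - g (qs (c (q (g f)))))
    (g_right : ∀ x : E, Δ (g x) + qs (A (q (g x))) = x) (c_right : ∀ φ : F, q (g (g (qs (c φ)))) = φ) (f : E) :
    Δ (g (R f)) = R f := by
  have h1 := g_right (R f)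
  rw [q_g_proj325 hR c_right f, map_zero, map_zero, add_zero] at h1
  exact h1

/-- `R² = R` (from the two previous identities: `R(R f) = R f − G′Q′\*c(Q′G′R f) = R f`). [cite: Balaban1985BackgroundPropagators, (3.25) p.394] -/
theorem proj325_idem (hR : ∀ f, R f = f - g (qs (c (q (g f)))))
    (c_right : ∀ φ : F, q (g (g (qs (c φ)))) = φ) (f : E) : R (R f) = R f := by
  conv_lhs => rw [hR, q_g_proj325 hR c_right f]
  rw [map_zero, map_zero, map_zero, sub_zero]

/-- **(1.93) ⟺ (1.95)**: for `λ` with `Q′λ = 0`, the Landau condition of the gauge-fixed datum «R(Y − Δλ) = 0» is «Δλ = R Y» (since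
`RΔλ = Δλ`). [cite: Balaban1985RegularSpaces, (1.93)–(1.95) p.92] -/
theorem lap_eq_proj325_iff_of_ker (hR : ∀ f, R f = f - g (qs (c (q (g f)))))
    (g_left : ∀ x : E, g (Δ x + qs (A (q x))) = x) {lam : E} (hlam : q lam = 0) (Y : E) :
    R (Y - Δ lam) = 0 ↔ Δ lam = R Y := by
  rw [proj325_sub hR, proj325_lap_of_ker hR g_left hlam, sub_eq_zero, eq_comm]

/-- **(1.95) ⟺ (1.100)**: `λ = G′R Y ⟺ (Q′λ = 0 ∧ Δλ = R Y)` — «If λ is a solution of [(1.100)], then λ satisfies both Eqs. (1.95)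
because Q′G′R = 0 [and ΔG′R = R]. Of course (1.95) imply (1.100)» (`λ = G′Δ′_aλ = G′Δλ` when `Q′λ = 0`).
[cite: Balaban1985RegularSpaces, (1.100) p.93] -/
theorem eq_g_proj325_iff (hR : ∀ f, R f = f - g (qs (c (q (g f)))))
    (g_left : ∀ x : E, g (Δ x + qs (A (q x))) = x) (g_right : ∀ x : E, Δ (g x) + qs (A (q (g x))) = x)
    (c_right : ∀ φ : F, q (g (g (qs (c φ)))) = φ) (lam Y : E) :
    lam = g (R Y) ↔ q lam = 0 ∧ Δ lam = R Y := by
  constructor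
  · rintro rfl
    exact ⟨q_g_proj325 hR c_right Y, lap_g_proj325 hR g_right c_right Y⟩
  · rintro ⟨hq, hlap⟩
    have := g_left lam
    rw [hq, map_zero, map_zero, add_zero, hlap] at this
    exact this.symm

/-- **THE FIXED-POINT EQUATION ⟺ (LINEARISED RESTRICTION ∧ LANDAU CONDITION OF THE GAUGE-FIXED FIELD)** — print's «(1.90) ⟺ (1.95)
⟺ (1.100)» with the nonlinearity an ARBITRARY map `N : E → E` (for Proposition 5, `N λ = −𝔊(λ, Dλ, A, D\*A)`; for Theorem 8 also
the source term): `λ = G′R(Y − Nλ) ⟺ Q′λ = 0 ∧ R(Y − Δλ − Nλ) = 0`, where `Y − Δλ − Nλ` is the `D\*` of the exponent of the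
gauge-fixed field by (1.86)–(1.88). [cite: Balaban1985RegularSpaces, (1.90) p.91, (1.95)–(1.100) pp.92–93] -/
theorem fixedPoint_iff_constraint_and_landau (hR : ∀ f, R f = f - g (qs (c (q (g f)))))
    (g_left : ∀ x : E, g (Δ x + qs (A (q x))) = x) (g_right : ∀ x : E, Δ (g x) + qs (A (q (g x))) = x)
    (c_right : ∀ φ : F, q (g (g (qs (c φ)))) = φ) (N : E → E) (lam Y : E) :
    lam = g (R (Y - N lam)) ↔ q lam = 0 ∧ R (Y - Δ lam - N lam) = 0 := by
  rw [eq_g_proj325_iff hR g_left g_right c_right lam (Y - N lam)]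
  constructor
  · rintro ⟨hq, hlap⟩
    refine ⟨hq, ?_⟩
    rw [sub_right_comm, lap_eq_proj325_iff_of_ker hR g_left hq]
    exact hlap
  · rintro ⟨hq, hlan⟩
    refine ⟨hq, ?_⟩
    rw [sub_right_comm, lap_eq_proj325_iff_of_ker hR g_left hq] at hlan
    exact hlan

/-- **THE SAME WITH THE LANDAU CONDITION IN MULTIPLIER FORM** (`B8Eq138Multiplier.proj325_apply_eq_zero_iff_exists`): `λ = G′R(Y − Nλ)
⟺ Q′λ = 0 ∧ ∃ μ, Δ(Y − Δλ − Nλ) = Q′\* μ` — what a Proposition-5 provider hands to the Theorem-4 knit at `Lan :=` the multiplier-form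
predicate (`B8Eq138LandauZd.IsLandau138W` on the `ℤᵈ × 𝔸` carriers): exhibit the fixed point, read off (1.38) for the gauge-fixed field
and the linearised (1.29). [cite: Balaban1985RegularSpaces, (1.100) p.93, (1.38) p.82; Balaban1985BackgroundPropagators, (3.25) p.394] -/
theorem fixedPoint_iff_constraint_and_multiplier (hR : ∀ f, R f = f - g (qs (c (q (g f)))))
    (g_left : ∀ x : E, g (Δ x + qs (A (q x))) = x) (g_right : ∀ x : E, Δ (g x) + qs (A (q (g x))) = x)
    (c_left : ∀ φ : F, c (q (g (g (qs φ)))) = φ) (c_right : ∀ φ : F, q (g (g (qs (c φ)))) = φ) (N : E → E) (lam Y : E) :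
    lam = g (R (Y - N lam)) ↔ q lam = 0 ∧ ∃ μ : F, Δ (Y - Δ lam - N lam) = qs μ := by
  rw [fixedPoint_iff_constraint_and_landau hR g_left g_right c_right N lam Y, hR,
    proj325_apply_eq_zero_iff_exists g_left g_right c_left]

end Skeleton

#print axioms fixedPoint_iff_constraint_and_multiplier

end Literature.MathematicalPhysics.QuantumFieldTheory.Balaban1983to89.B8Eq195Linear
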